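import Summits.AnomalousDissipation.AnomalousDissipation.Theorems.SolenoidalFractalHomogenisationLagrangianStepVmodSSRegimesB
import Summits.AnomalousDissipation.AnomalousDissipation.Theorems.SolenoidalFractalHomogenisationLagrangianStepVmodSSSmall
import Summits.AnomalousDissipation.AnomalousDissipation.Theorems.SolenoidalFractalHomogenisationLagrangianStepVmodBridge
import HarnessLib

/-!
# K1L_D (stmt-AnomalousDissipation-27980): (V_mod) flat stage, block (ss) — THE EIGHT-LEAF DISPATCH of one instance of the grid-anchored
# single-mode defect estimate onto the regime lemmas `…VmodSSRegimesA–D` / `…VmodSSSmall`, with all constants as hypotheses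
(helper; `--supports 27980 --as helper`; prover ad-sawtooth-k1loc-p1 g15; the constants are CHOSEN in `…VmodSSModeGrid`.)

Leaves: `τ ≤ P`: T-G (`Rτ ≤ 1`) / trivial (`Rτ ≥ 1`); `τ > P`, coarse (`‖ℓ‖⌈K/ν⌉ ≤ g₀n`): T-V (`Rτ ≤ 2`) / `ν`-floor (`ν ≥ t₀`) / T-I;
`τ > P`, high: T-G charged to `(P/τ)^e` (`Rτ ≤ 1`) / `HighLabelDecayW` + carrier-free decay (`Rτ ≥ 1`).
`sorry`-free; NOT a proof of (ss) for mid-period starts, of the stub, of K1L_D or of AD; rung F-D1.A0.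
-/

set_option linter.dupNamespace false

noncomputable section

namespace Summit.AnomalousDissipation.AnomalousDissipation.Theorems.SolenoidalFractalHomogenisation.LagrangianStep.VmodGen

open Set MeasureTheory Complex UnitAddTorus
open scoped InnerProductSpace ENNReal
open Literature.Analysis Literature.Analysis.FunctionSpaces Literature.Analysis.FunctionSpaces.Torus
open Literature.Analysis.FluidPDE Literature.Analysis.FluidPDE.Torus Literature.Analysis.FluidPDE.LatticeShear
open Summit.AnomalousDissipation.AnomalousDissipation.Theorems.SolenoidalFractalHomogenisation.LagrangianStep.Sideband (slotAmp)
open Summit.AnomalousDissipation.AnomalousDissipation.Theorems.SolenoidalFractalHomogenisation.LagrangianStep.VmodFlat (fc loT dW)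

section Clause

variable {k : ℕ} {W : LatticeWord k} {M : ℝ} {hM : 0 < M} {c : ℝ}
  {Φ : ℝ → Visc4 (Fin 3) → Visc4 (Fin 3)} {lo hi Λ β σ C ν₀ K : ℝ}
  {ν : ℝ} {n : ℕ} {𝔸 : Visc4 (Fin 3)} {Tw : ℝ} {U T : ℝ → ℝ → (V2 →L[ℝ] V2)}

set_option maxHeartbeats 3200000 in
/-- **The dispatch.**  See the module docstring. -/
theorem defect_le_alw_dispatch (hV : SlowVectorClauseF W M hM c Φ lo hi Λ β σ C ν₀ K)
    {νh Kb CK cK : ℝ} (hH : HighLabelDecayW W M hM lo hi Λ β νh Kb CK cK) (hCK : 1 ≤ CK) (hcK : 0 < cK) (hνh : 0 < νh)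
    (hlo : 0 < lo) (hhi : 1 ≤ hi) (hΛ : 1 < Λ) (hβ : 0 ≤ β) (hσ : 0 < σ) (hC : 0 ≤ C) (hν₀1 : ν₀ ≤ 1) (hK : 0 < K) (hc : 0 < c)
    {e : ℝ} (heσ : e ≤ σ / 2) (he12 : e ≤ 1 / 2)
    {g₀ t₀ θ' C₁ : ℝ} (hg₀0 : 0 < g₀) (hg₀1 : g₀ ≤ 1) (hKb : Kb = (K + 1) / g₀)
    (hgσ : 2 * Real.sqrt 2 * C ^ 2 * g₀ ^ σ ≤ 1 / 50) (ht₀0 : 0 < t₀) (hνcσ : 2 * Real.sqrt 2 * C ^ 2 * t₀ ^ σ ≤ 1 / 50)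
    (hAg : (8 * Real.pi ^ 2 * (lo / Λ) * (M * W.period) * (1 + c) / K ^ 2) * g₀ ≤ (1 / (50 * (2 * Real.sqrt 2 * C * (hi * Λ ^ 2 / lo) + 1))))
    (hBg : (12 * k * Real.exp (9 * (k : ℝ) ^ 2 / (2 * Real.pi ^ 4 * (lo / Λ) ^ 2 * c)) / (Real.pi ^ 2 * (lo / Λ) * K)) * g₀ ≤ 1 / 50)
    (hBsg : (24 * (∑ j, ‖slotAmp W j‖) / (Real.pi * (lo / Λ) * K)) * g₀ ≤ 1 / 50)
    (hgd : 16 * (1 + c) * g₀ / K ^ 2 ≤ 1 / 50)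
    (hθ'0 : 0 < θ') (hθ'L : θ' ≤ (8 * Real.pi ^ 2 * (lo / Λ) * (M * W.period) * c * g₀ ^ 2 / (K + 1) ^ 2))
    (hC₁1 : 1 ≤ C₁) (hC₁6 : 6 ≤ C₁) (hC₁G : 2 * ((4 * Real.pi ^ 2 * c * (hi * Λ + β / 2) + 32 * Real.sqrt 2 * Λ * (∑ j, ‖slotAmp W j‖) ^ 2 / lo) * Λ / (8 * Real.pi ^ 2 * c * lo)) ≤ C₁) (hC₁Gθ : 2 * ((4 * Real.pi ^ 2 * c * (hi * Λ + β / 2) + 32 * Real.sqrt 2 * Λ * (∑ j, ‖slotAmp W j‖) ^ 2 / lo) * Λ / (8 * Real.pi ^ 2 * c * lo)) ≤ C₁ * θ') (hC₁h : 6 / νh ≤ C₁)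
    (hC₁d : (4 * Real.sqrt (2 * CK) / (cK * (M * W.period)) + 8 / θ') ≤ C₁) (hC₁t : 6 / t₀ ≤ C₁)
    (hC₁a3 : 8 * Real.sqrt 2 * (hi * Λ ^ 2 / lo) * C ^ 2 ≤ C₁ * C₁)
    (hC₁b3 : 8 * Real.sqrt 2 * (hi * Λ ^ 2 / lo) * (C ^ 2 * (2 * ((K + 1) ^ 2 / (8 * Real.pi ^ 2 * (lo / Λ) * (M * W.period) * c))) ^ (σ / 2) + C) ≤ C₁)
    (hC₁a7 : 2 * 265 * (2 * Real.sqrt 2) * C ^ 2 ≤ C₁ * C₁)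
    (hC₁b7 : 4 * 265 * (2 * Real.sqrt 2 * C ^ 2 * ((K + 1) ^ 2 / (8 * Real.pi ^ 2 * (lo / Λ) * (M * W.period) * c)) ^ (σ / 2) + 2 * Real.sqrt 2 * C * (hi * Λ ^ 2 / lo) + (12 * k * Real.exp (9 * (k : ℝ) ^ 2 / (2 * Real.pi ^ 4 * (lo / Λ) ^ 2 * c)) / (Real.pi ^ 2 * (lo / Λ) * Real.sqrt (8 * Real.pi ^ 2 * (lo / Λ) * (M * W.period) * c)))) ≤ C₁)
    (hν : ν ∈ Set.Ioo 0 ν₀) (hn : (⌈K / ν⌉₊ : ℝ) ≤ n) (hodd : OddSmall 𝔸 (ν * β))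
    (hwin : ∃ lam ∈ Set.Icc (1:ℝ) Λ, NearIso 𝔸 (ν * (lo / lam)) (ν * (hi * lam)))
    (hΦo : OddSmall (Φ ν ((1 / ν) • 𝔸)) β) (hΦw : ∃ lam ∈ Set.Icc (1:ℝ) Λ, NearIso (Φ ν ((1 / ν) • 𝔸)) (lo / lam) (hi * lam))
    (hU : IsPropagator Tw (cellField W M hM ν hν.1 n) ((1 / (n:ℝ) ^ 2) • 𝔸) U)
    (hT : IsPropagator Tw (fun (_ : ℝ) (_ : UnitAddTorus (Fin 3)) => (0 : EuclideanSpace ℝ (Fin 3)))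
      ((1 / (n:ℝ) ^ 2) • (𝔸 + (c / ν) • Φ ν ((1 / ν) • 𝔸))) T)
    {s t : ℝ} (hs : 0 ≤ s) (hst : s < t) (htT : t ≤ Tw) (j₀ : ℕ) (hs₀ : s = j₀ * (M * W.period / ν))
    {ℓ : Fin 3 → ℤ} (hℓ : ℓ ∈ (Torus.freqBall (d := Fin 3) (n / 4)).erase 0)
    (v : V2) (hv : v ∈ divFreeL2 (Fin 3)) (hvs : ∀ k', k' ≠ ℓ → k' ≠ -ℓ → fc v k' = 0) :
    ‖fc (U s t v - T s t v) ℓ‖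
      ≤ (C₁ * (C₁ * (ν ^ e + ((⌈K / ν⌉₊ : ℝ) / n) ^ e) + (min 1 ((M * W.period / ν) / (t - s))) ^ e))
        * dW lo Λ c ν n (t - s) ℓ * ‖fc v ℓ‖ := by
  have he1 : e ≤ 1 := by linarith only [he12]
  have hΛ1 : 1 ≤ Λ := hΛ.le
  have hΛ0 : 0 < Λ := by linarith only [hΛ]
  have hhi0 : 0 ≤ hi := by linarith only [hhi]
  have hloΛ : 0 < lo / Λ := div_pos hlo hΛ0
  have hWp := PermissibleCarrier.period_pos W
  have hMW : 0 < M * W.period := mul_pos hM hWp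
  have hC₁0 : 0 ≤ C₁ := by linarith only [hC₁1]
  have hν1 : ν ≤ 1 := hν.2.le.trans hν₀1
  have hceil1 : (1:ℝ) ≤ (⌈K / ν⌉₊ : ℝ) := by
    exact_mod_cast Nat.one_le_iff_ne_zero.2 (Nat.pos_iff_ne_zero.1 (Nat.ceil_pos.2 (div_pos hK hν.1)))
  have hn1 : 1 ≤ n := by exact_mod_cast (hceil1.trans hn)
  have hn0 : (0:ℝ) < n := by exact_mod_cast (show 0 < n from hn1)
  obtain ⟨hℓ0, hℓB⟩ := Finset.mem_erase.1 hℓ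
  have hLb : 2 * (n / 4) < n := by omega
  -- `|ℓ| ≤ n/4`
  have hqle : Torus.freqNormSq ℓ ≤ ((n / 4 : ℕ) : ℝ) ^ 2 := Torus.mem_freqBall.1 hℓB
  have hsq : Real.sqrt (Torus.freqNormSq ℓ) ≤ (n:ℝ) / 4 := by
    have h1 : Real.sqrt (Torus.freqNormSq ℓ) ≤ ((n / 4 : ℕ) : ℝ) := by
      rw [← Real.sqrt_sq (Nat.cast_nonneg (n / 4))]; exact Real.sqrt_le_sqrt hqle
    exact h1.trans (Nat.cast_div_le.trans (by norm_num))
  have hℓn : 2 * Real.sqrt (Torus.freqNormSq ℓ) < n := by linarith only [hsq, hn0]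
  have hℓn' : 2 * ‖Torus.latticeVec ℓ‖ ≤ n := by rw [norm_latticeVec_eq_sqrt]; linarith only [hsq, hn0]
  -- the carrier phase at a grid start
  have hphase : ∀ τ, cellField W M hM ν hν.1 n (s + τ) = cellField W M hM ν hν.1 n τ := by
    intro τ; rw [hs₀]; exact cellField_add_nat_mul_period W M hM ν hν.1 n j₀ τ
  -- ### the dispatch
  by_cases hτP : t - s ≤ M * W.period / ν
  · by_cases hR1 : 8 * Real.pi ^ 2 * loT lo Λ c ν n * Torus.freqNormSq ℓ * (t - s) ≤ 1
    · exact defect_le_alw_of_short_gen hlo hhi0 hΛ1 hβ hc hν hn1 hwin hΦo hΦw hU hT hs hst htT hphase hℓ0 hℓn v hv hvs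
        hC₁0 hC₁G hR1 hτP
    · exact defect_le_alw_of_short_triv hν hn1 hU hT hst hℓ0 v hvs hC₁6 (not_le.1 hR1).le hτP
  · push Not at hτP
    by_cases hco : ‖Torus.latticeVec ℓ‖ * (⌈K / ν⌉₊ : ℝ) ≤ g₀ * n
    · -- coarse labels
      have hscale : ‖Torus.latticeVec ℓ‖ * (⌈K / ν⌉₊ : ℝ) ≤ n := hco.trans (by nlinarith only [hg₀1, hn0])
      by_cases hR2 : 8 * Real.pi ^ 2 * loT lo Λ c ν n * Torus.freqNormSq ℓ * (t - s) ≤ 2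
      · exact defect_le_alw_of_scale_mid hV hlo hhi0 hΛ1 hc hC hσ hK.le hν hν1 hn1 hodd hwin hΦw hU hT hs hst htT hphase hLb hℓ0 hℓB
          hscale v hv hvs hC₁0 hC₁a3 hC₁b3 heσ he1 hR2 hτP
      · push Not at hR2
        by_cases hνc : t₀ ≤ ν
        · exact defect_le_alw_of_floor hν hν1 hn1 hU hT hst hℓ0 v hvs hC₁1 ht₀0 hC₁t hνc he1 (by linarith only [hR2])
        · push Not at hνc
          obtain ⟨hRP, hρ⟩ := coarse_smallness W hC hσ hc hlo hhi0 hΛ1 hM hν.1 hν1 hK hn1 hℓ0 hg₀0 hg₀1 hνc.le hco hgσ hνcσ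
            hAg hBg hBsg hgd
          exact defect_le_alw_of_scale_iter hV hlo hhi0 hΛ1 hc hC hσ hK.le hν hν1 hn1 hodd hwin hΦw hU hT j₀ hs₀ hst htT hLb hℓ0 hℓB
            hscale v hv hvs hC₁0 hC₁a7 hC₁b7 heσ he12 hρ hRP hR2.le
    · -- high labels
      push Not at hco
      obtain ⟨hKbL, hθRP⟩ := high_label_bounds hloΛ.le hc.le hMW.le hν.1 hν1 hK.le hn1 hg₀0 hco
      rw [← hKb] at hKbL
      have hθ'RP : θ' ≤ 8 * Real.pi ^ 2 * loT lo Λ c ν n * Torus.freqNormSq ℓ * (M * W.period / ν) := hθ'L.trans hθRP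
      by_cases hR1 : 8 * Real.pi ^ 2 * loT lo Λ c ν n * Torus.freqNormSq ℓ * (t - s) ≤ 1
      · exact defect_le_alw_of_high_gen hlo hhi0 hΛ1 hβ hc hν hn1 hwin hΦo hΦw hU hT hs hst htT hphase hℓ0 hℓn v hv hvs
          hC₁0 hC₁Gθ hθ'RP he1 hR1 hτP
      · exact defect_le_alw_of_high_long hH hCK hcK hνh hlo hhi0 hΛ1 hc.le hν hν1 hn1 hodd hwin hΦw hU hT hs hst htT hphase
          hℓ0 hℓn' hKbL v hv hvs hC₁1 hC₁h hθ'0 hθ'RP hC₁d he1 (not_le.1 hR1).le hτP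

end Clause

end Summit.AnomalousDissipation.AnomalousDissipation.Theorems.SolenoidalFractalHomogenisation.LagrangianStep.VmodGen

end
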